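import Summits.QuantumFields.QCD.Theses.NestedDissectionSea
import Summits.QuantumFields.QCD.Theorems.CoerciveSea.Negative.CellDeterminants
import Summits.QuantumFields.QCD.Theorems.NestedDissectionSeaCoerciveSeaCrossingSojourn
import Literature.Analysis.InnerProduct.EigenvalueBranchCrossing

/-!
# Crux `CoerciveSea` (stmt-QuantumFields-13901), line `chirality-collapses-pseudospectrum`,
# stub A″ (`stub_chiralPileupRareOfPinned`) — its deterministic core:
# A CHIRAL MEMBER FORCES A CROSSING (or a non-chiral window vector) within `|ev|/χ₀` of the mass

Helper file of the line lead (lead-1) for the hardest stub. A member of the A″ event is a unit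
eigenvector `u` of the Hermitian Dirichlet Wilson cell pencil, `D_c(μ) u = ev · Γ_c u`
(`D_c(μ) = wilsonCell U μ 0 s`, `Γ_c = diag (γ₅)_{αα} = ±1`), with `|ev| < 2t/s₀` and chirality
`|χ(u)| ≥ χ₀`, `χ(u) = Σ_p conj(u_p)(γ₅)_{α_pα_p} u_p`. Since `D_c(μ') = D_c(μ) + (μ' − μ)·1`
(landed `wilsonCell_eq_add_scalar_sub`), the Hermitian family `H(μ') = Γ_c D_c(μ')` is the PENCIL
`H(μ) + (μ' − μ) Γ_c`, and the Literature crossing theorem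
(`Literature.Analysis.InnerProduct.exists_pencil_eigenvalue_zero_or_nonchiral`: Weyl continuity +
Courant–Fischer Dini-slope + fencing + IVT) gives, for every such member:

* `chiHermitian_member_forces_crossing_or_nonchiral` (generic `χ`-Hermitian matrix `D`,
  `χ_p = ±1`): a non-zero `u` with `D u = ev χ u`, `ev > 0`, `re χ(u) ≥ χ₀ ‖u‖²` forces some
  `x ∈ [0, ev/χ₀]` with `det (D − x·1) = 0` OR a non-zero `v`, `c ∈ (0, ev]`, `(D − x·1) v = c χ v`,
  `re χ(v) < χ₀ ‖v‖²`;
* `chiral_member_forces_crossing_or_nonchiral` (the crux cell, ALL FOUR SIGN CASES at once,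
  registered sub-goal of stub 4): for a non-zero pencil eigenvector `u` of `wilsonCell U μ 0 s` with
  eigenvalue `ev ≠ 0` (sign `τ`) and directed chirality `σ · re χ(u) ≥ χ₀ Σ‖u_p‖²` (`σ, τ ∈ {1, −1}`,
  `0 < χ₀ ≤ 1`), there is `x ∈ [0, |ev|/χ₀]` such that at the mass `μ' = μ − σ τ x` (BELOW `μ` when
  `ev` and `χ(u)` have the same sign, ABOVE otherwise) EITHER `det (wilsonCell U μ' 0 s) = 0` — a
  crossing of the cell, i.e. exactly the currency of `EarlyCrosserLaw`/`SignDefectForcesCrossing` —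
  OR the cell pencil at `μ'` has a non-zero eigenvector `v` with eigenvalue `c`, `0 < τ c ≤ |ev|`
  (same sign as `ev`, not larger), whose directed chirality is below the cut,
  `σ · re χ(v) < χ₀ Σ‖v_p‖²` (an ACHIRAL vector of the B″ sector at a finer level, or a coincidence
  with an oppositely-chiral level).

Consequence for the A″-law (docstring of stub 4, "ENGINE"): `A″_t ⊆` {sheet-weighted Stieltjes
pile-up of cell CROSSINGS within `2t/(χ₀ s₀)` of the valence mass} `∪` {a non-chiral window vector
at a nearby mass} — the promoted item is a NEAR-CROSSING DENSITY law (quantitative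
`EarlyCrosserLaw` at resolution `t/s₀²`), plus the fine-level B″ law. [folklore]
-/

noncomputable section

open scoped BigOperators InnerProductSpace ComplexConjugate
open Matrix WithLp Module

namespace Summit.QuantumFields.QCD.Cruxes.CoerciveSea.ChiralityCollapsesPseudospectrum

namespace ChiralForcesCrossing

/-! ### Generic part: `χ`-Hermitian matrices -/

section Generic

variable {ι : Type*} [Fintype ι] [DecidableEq ι]

/-- `diag χ · D` is Hermitian for a `χ`-Hermitian `D` (`conj D_{ji} = χ_i D_{ij} χ_j`, `χ² = 1`,
`χ` real). [folklore] -/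
theorem isHermitian_diagonal_mul (D : Matrix ι ι ℂ) (χ : ι → ℂ) (hχ2 : ∀ p, χ p * χ p = 1)
    (hχs : ∀ p, star (χ p) = χ p) (hD : ∀ i j, star (D j i) = χ i * D i j * χ j) :
    (diagonal χ * D).IsHermitian := by
  refine Matrix.IsHermitian.ext fun i j => ?_
  rw [diagonal_mul, diagonal_mul, star_mul', hD, hχs]
  linear_combination (χ i * D i j) * hχ2 j

omit [Fintype ι] in
/-- `diag χ` is Hermitian for real `χ`. [folklore] -/
theorem isHermitian_diagonal' (χ : ι → ℂ) (hχs : ∀ p, star (χ p) = χ p) :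
    (diagonal χ : Matrix ι ι ℂ).IsHermitian := by
  refine Matrix.IsHermitian.ext fun i j => ?_
  by_cases h : i = j
  · subst h; simp [hχs]
  · simp [diagonal_apply_ne _ h, diagonal_apply_ne _ (Ne.symm h)]

/-- **Generic crossing theorem for `χ`-Hermitian matrices (positive case).** Let `D` be
`χ`-Hermitian (`χ_p = ±1` real), `u ≠ 0` with `D u = ev χ u`, `ev > 0`, and `0 < χ₀ ≤ 1`. Then for
some `x ∈ [0, ev/χ₀]` either
`det (D − x·1) = 0`, or there are `v ≠ 0` and `c ∈ (0, ev]` with `(D − x·1) v = c χ v` and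
`re Σ conj(v_p) χ_p v_p < χ₀ Σ ‖v_p‖²` (trivially so at `x = 0`, `v = u` unless `u` is `χ₀`-chiral,
`re χ(u) ≥ χ₀ ‖u‖²` — the case of interest). The Hermitian pencil `diag χ · (D − x·1) = H − x·diag χ`
and `Literature.Analysis.InnerProduct.exists_pencil_eigenvalue_zero_or_nonchiral`. [folklore] -/
theorem chiHermitian_member_forces_crossing_or_nonchiral (D : Matrix ι ι ℂ) (χ : ι → ℂ)
    (hχ2 : ∀ p, χ p * χ p = 1) (hχs : ∀ p, star (χ p) = χ p)
    (hD : ∀ i j, star (D j i) = χ i * D i j * χ j) (u : ι → ℂ) (hu0 : u ≠ 0) {ev χ₀ : ℝ}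
    (hev : 0 < ev) (hχ₀ : 0 < χ₀) (hχ₁ : χ₀ ≤ 1)
    (heig : D *ᵥ u = fun p => (ev : ℂ) * χ p * u p) :
    ∃ x ∈ Set.Icc (0 : ℝ) (ev / χ₀),
      (D - ((x : ℝ) : ℂ) • (1 : Matrix ι ι ℂ)).det = 0 ∨
      ∃ v : ι → ℂ, v ≠ 0 ∧ ∃ c : ℝ,
        ((D - ((x : ℝ) : ℂ) • (1 : Matrix ι ι ℂ)) *ᵥ v = fun p => (c : ℂ) * χ p * v p) ∧
        0 < c ∧ c ≤ ev ∧ (∑ p, star (v p) * χ p * v p).re < χ₀ * ∑ p, ‖v p‖ ^ 2 := by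
  -- the operators
  set T₀ : EuclideanSpace ℂ ι →ₗ[ℂ] EuclideanSpace ℂ ι := Matrix.toEuclideanLin (diagonal χ * D)
    with hT₀def
  set G : EuclideanSpace ℂ ι →ₗ[ℂ] EuclideanSpace ℂ ι := Matrix.toEuclideanLin (diagonal χ)
    with hGdef
  have hT₀ : T₀.IsSymmetric :=
    Matrix.isSymmetric_toEuclideanLin_iff.mpr (isHermitian_diagonal_mul D χ hχ2 hχs hD)
  have hG : G.IsSymmetric := Matrix.isSymmetric_toEuclideanLin_iff.mpr (isHermitian_diagonal' χ hχs)
  have hχnorm : ∀ p, ‖χ p‖ = 1 := fun p => by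
    have h : ‖χ p‖ ^ 2 = 1 := by rw [sq, ← norm_mul, hχ2, norm_one]
    exact (pow_eq_one_iff_of_nonneg (norm_nonneg _) two_ne_zero).mp h
  have hχne : ∀ p, χ p ≠ 0 := fun p h => by simpa [h] using hχ2 p
  -- coordinates of the pencil
  have hGapply : ∀ (v : EuclideanSpace ℂ ι) (p : ι), G v p = χ p * v p := fun v p => by
    simp [hGdef, Matrix.toLpLin_apply, mulVec_diagonal]
  have hPapply : ∀ (x : ℝ) (v : EuclideanSpace ℂ ι) (p : ι),
      (T₀ - ((x : ℝ) : ℂ) • G) v p = χ p * ((D - ((x : ℝ) : ℂ) • (1 : Matrix ι ι ℂ)) *ᵥ ofLp v) p := by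
    intro x v p
    simp only [LinearMap.sub_apply, LinearMap.smul_apply, hT₀def, hGdef, Matrix.toLpLin_apply,
      PiLp.sub_apply, PiLp.smul_apply, smul_eq_mul, ← mulVec_mulVec, mulVec_diagonal, sub_mulVec,
      Matrix.smul_mulVec, one_mulVec, Pi.sub_apply, Pi.smul_apply]
    ring
  have hGn : ∀ v : EuclideanSpace ℂ ι, ‖G v‖ ≤ ‖v‖ := fun v => by
    apply le_of_eq
    rw [EuclideanSpace.norm_eq, EuclideanSpace.norm_eq]
    congr 1
    exact Finset.sum_congr rfl fun p _ => by rw [hGapply, norm_mul, hχnorm, one_mul]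
  have hGform : ∀ v : EuclideanSpace ℂ ι,
      RCLike.re ⟪G v, v⟫_ℂ = (∑ p, star (v p) * χ p * v p).re := fun v => by
    have hsum : ⟪G v, v⟫_ℂ = ∑ p, star (v p) * χ p * v p := by
      rw [EuclideanSpace.inner_eq_star_dotProduct, dotProduct]
      refine Finset.sum_congr rfl fun p _ => ?_
      change v p * star (G v p) = _
      rw [hGapply, star_mul', hχs]
      ring
    rw [hsum]
    rfl
  have hnorm : ∀ v : EuclideanSpace ℂ ι, ‖v‖ ^ 2 = ∑ p, ‖v p‖ ^ 2 := EuclideanSpace.norm_sq_eq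
  -- `ev` is an eigenvalue of `T₀ = T₀ − 0·G`
  set uE : EuclideanSpace ℂ ι := toLp 2 u with huE
  have huE0 : uE ≠ 0 := fun h => hu0 (by simpa [huE] using congrArg ofLp h)
  have hev0 : Module.End.HasEigenvalue (T₀ - (((0 : ℝ) : ℝ) : ℂ) • G) (ev : ℂ) := by
    refine Module.End.hasEigenvalue_of_hasEigenvector ⟨Module.End.mem_eigenspace_iff.2 ?_, huE0⟩
    ext p
    rw [hPapply, PiLp.smul_apply, smul_eq_mul]
    simp only [Complex.ofReal_zero, zero_smul, sub_zero, huE, heig]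
    calc χ p * ((ev : ℂ) * χ p * u p) = (ev : ℂ) * (χ p * χ p) * u p := by ring
      _ = (ev : ℂ) * u p := by rw [hχ2, mul_one]
  set hn := (finrank_euclideanSpace : finrank ℂ (EuclideanSpace ℂ ι) = Fintype.card ι) with hndef
  obtain ⟨i, hi⟩ := (Literature.Analysis.InnerProduct.isSymmetric_sub_real_smul hT₀ hG 0)
    |>.exists_eigenvalues_eq hn hev0
  have hei : (Literature.Analysis.InnerProduct.isSymmetric_sub_real_smul hT₀ hG 0).eigenvalues hn i
      = ev := RCLike.ofReal_injective hi
  -- the abstract crossing theorem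
  obtain ⟨x, hx, halt⟩ :=
    Literature.Analysis.InnerProduct.exists_pencil_eigenvalue_zero_or_nonchiral hT₀ hG hGn hn i hev
      hei hχ₀ hχ₁
  refine ⟨x, hx, ?_⟩
  rcases halt with ⟨v, hv0, hv⟩ | ⟨v, hv0, c, hv, hc, hce, hform⟩
  · -- kernel vector ⇒ `det (D − x·1) = 0`
    left
    have hv' : ∀ p, (T₀ - ((x : ℝ) : ℂ) • G) v p = 0 := fun p => by
      have := congrArg (fun w : EuclideanSpace ℂ ι => w p) hv
      exact this
    refine (Matrix.exists_mulVec_eq_zero_iff).1 ⟨ofLp v, fun h => hv0 ?_, ?_⟩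
    · ext p
      exact congrFun h p
    · funext p
      have hp := hv' p
      rw [hPapply] at hp
      rcases mul_eq_zero.1 hp with h | h
      · exact absurd h (hχne p)
      · exact h
  · -- non-chiral window vector
    right
    have hv' : ∀ p, (T₀ - ((x : ℝ) : ℂ) • G) v p = (c : ℂ) * v p := fun p => by
      have := congrArg (fun w : EuclideanSpace ℂ ι => w p) hv
      exact this
    refine ⟨ofLp v, fun h => hv0 ?_, c, ?_, hc, hce, ?_⟩
    · ext p
      exact congrFun h p
    · funext p
      have hp := hv' p
      rw [hPapply] at hp
      calc ((D - ((x : ℝ) : ℂ) • (1 : Matrix ι ι ℂ)) *ᵥ ofLp v) p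
          = χ p * (χ p * ((D - ((x : ℝ) : ℂ) • (1 : Matrix ι ι ℂ)) *ᵥ ofLp v) p) := by
            rw [← mul_assoc, hχ2, one_mul]
        _ = χ p * ((c : ℂ) * v p) := by rw [hp]
        _ = (c : ℂ) * χ p * (ofLp v) p := by ring
    · have h1 := hGform v
      have h2 := hnorm v
      have hform' : RCLike.re ⟪G v, v⟫_ℂ < χ₀ * ‖v‖ ^ 2 := hform
      rw [h1, h2] at hform'
      exact hform'

end Generic

/-! ### The crux cell: all four sign cases -/

open Literature.MathematicalPhysics.QuantumLattice Literature.MathematicalPhysics.QuantumFieldTheory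
  Literature.Probability.LatticeModels

/-- `(γ₅)_{αα} = ±1`: square one. [folklore] -/
theorem gammaFive_diag_mul_self (α : Fin 4) : gammaFive α α * gammaFive α α = 1 := by
  rw [gammaFive_eq_diagonal, diagonal_apply_eq]
  exact Summit.QuantumFields.QCD.Theorems.CoerciveSeaNegative.chiSign_sq α

/-- `(γ₅)_{αα}` is real. [folklore] -/
theorem star_gammaFive_diag (α : Fin 4) : star (gammaFive α α) = gammaFive α α := by
  rw [gammaFive_eq_diagonal, diagonal_apply_eq]
  fin_cases α <;> simp

/-- Entrywise `γ₅`-hermiticity of the Dirichlet Wilson cell (landed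
`CoerciveSeaNegative.conj_wilsonDirac_apply`, restricted to the box). [folklore] -/
theorem star_wilsonCell_apply {N : ℕ} [NeZero N]
    (U : GaugeConfig 4 N (Matrix.specialUnitaryGroup (Fin 3) ℂ)) (μ : ℝ) (s : Fin 4 → ℕ)
    (i j : {p // wilsonBox (0 : TorusSite 4 N) s p}) :
    star (wilsonCell U μ 0 s j i) =
      gammaFive i.1.2.2 i.1.2.2 * wilsonCell U μ 0 s i j * gammaFive j.1.2.2 j.1.2.2 := by
  have hχ : ∀ α : Fin 4, gammaFive α α = (![1, 1, -1, -1] : Fin 4 → ℂ) α := fun α => by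
    rw [gammaFive_eq_diagonal, diagonal_apply_eq]
  rw [hχ, hχ]
  have h := Summit.QuantumFields.QCD.Theorems.CoerciveSeaNegative.conj_wilsonDirac_apply
    (fundamentalRep (Fin 3)) fundamentalRep_mem_unitaryGroup U μ i.1 j.1
  rw [starRingEnd_apply] at h
  exact h

/-- **A chiral member forces a crossing or a non-chiral window vector — the Dirichlet Wilson cell,
all four sign cases.** Let `u ≠ 0` be a pencil eigenvector of the cell at bare mass `μ`,
`D_c(μ) u = ev · Γ_c u`, with `ev ≠ 0` of sign `τ ∈ {1,−1}` (`0 < τ·ev`); fix a direction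
`σ ∈ {1,−1}` and a cut `0 < χ₀ ≤ 1` (the case of interest: `u` directed-chiral,
`σ · re χ(u) ≥ χ₀ Σ_p ‖u_p‖²`, `χ(u) = Σ_p conj(u_p)(γ₅)_{α_pα_p}u_p`; otherwise the conclusion holds
trivially at `x = 0` with `v = u`). Then for some `x ∈ [0, |ev|/χ₀]`, at the mass `μ' = μ − σ τ x` (below `μ` iff `ev` and `χ(u)` have the
same sign): EITHER `det D_c(μ') = 0` (a CROSSING of the cell — the currency of `EarlyCrosserLaw` /
`SignDefectForcesCrossing` / the sojourn lemma), OR the pencil at `μ'` has an eigenvector `v ≠ 0`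
with eigenvalue `c` of the sign of `ev` and `0 < τc ≤ |ev|`, whose directed chirality is below the
cut, `σ · re χ(v) < χ₀ Σ_p ‖v_p‖²`. Proof: the generic theorem for the `σχ`-Hermitian matrix
`στ·D_c(μ)` and `D_c(μ') = D_c(μ) + (μ' − μ)·1`. Registered sub-goal of stub 4
(`stub_chiralPileupRareOfPinned`): with it, `A″_t ⊆ {sheet-weighted Stieltjes pile-up of cell
crossings within 2t/(χ₀s₀) of the valence mass} ∪ {a non-chiral vector in the fine window nearby}`.
[folklore] -/
theorem chiral_member_forces_crossing_or_nonchiral :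
    ∀ (N : ℕ) [NeZero N] (U : GaugeConfig 4 N (Matrix.specialUnitaryGroup (Fin 3) ℂ))
      (s : Fin 4 → ℕ) (μ : ℝ) (u : {p // wilsonBox (0 : TorusSite 4 N) s p} → ℂ)
      (ev χ₀ σ τ : ℝ), u ≠ 0 →
      ((wilsonCell U μ 0 s).mulVec u = fun p => (ev : ℂ) * gammaFive p.1.2.2 p.1.2.2 * u p) →
      0 < χ₀ → χ₀ ≤ 1 → (σ = 1 ∨ σ = -1) → (τ = 1 ∨ τ = -1) → 0 < τ * ev →
      ∃ x : ℝ, 0 ≤ x ∧ x ≤ τ * ev / χ₀ ∧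
        ((wilsonCell U (μ - σ * τ * x) 0 s).det = 0 ∨
          ∃ v : {p // wilsonBox (0 : TorusSite 4 N) s p} → ℂ, v ≠ 0 ∧ ∃ c : ℝ,
            ((wilsonCell U (μ - σ * τ * x) 0 s).mulVec v =
                fun p => (c : ℂ) * gammaFive p.1.2.2 p.1.2.2 * v p) ∧
            0 < τ * c ∧ τ * c ≤ τ * ev ∧
            σ * (∑ p, star (v p) * gammaFive p.1.2.2 p.1.2.2 * v p).re < χ₀ * ∑ p, ‖v p‖ ^ 2) := by
  intro N _ U s μ u ev χ₀ σ τ hu0 heig hχ₀ hχ₁ hσ hτ hτev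
  -- signs
  have hσ2 : σ * σ = 1 := by rcases hσ with h | h <;> subst h <;> norm_num
  have hτ2 : τ * τ = 1 := by rcases hτ with h | h <;> subst h <;> norm_num
  have hσC : (σ : ℂ) * (σ : ℂ) = 1 := by exact_mod_cast hσ2
  have hτC : (τ : ℂ) * (τ : ℂ) = 1 := by exact_mod_cast hτ2
  have hστ0 : ((σ * τ : ℝ) : ℂ) ≠ 0 := by
    have : σ * τ ≠ 0 := by
      rcases hσ with h | h <;> rcases hτ with h' | h' <;> subst h <;> subst h' <;> norm_num
    exact_mod_cast this
  -- the `σχ`-Hermitian matrix `στ · D_c(μ)`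
  have hχ2' : ∀ p : {p // wilsonBox (0 : TorusSite 4 N) s p},
      (σ : ℂ) * gammaFive p.1.2.2 p.1.2.2 * ((σ : ℂ) * gammaFive p.1.2.2 p.1.2.2) = 1 := fun p => by
    linear_combination (gammaFive p.1.2.2 p.1.2.2 * gammaFive p.1.2.2 p.1.2.2) * hσC +
      gammaFive_diag_mul_self p.1.2.2
  have hχs' : ∀ p : {p // wilsonBox (0 : TorusSite 4 N) s p},
      star ((σ : ℂ) * gammaFive p.1.2.2 p.1.2.2) = (σ : ℂ) * gammaFive p.1.2.2 p.1.2.2 := fun p => by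
    rw [star_mul', star_gammaFive_diag, Complex.star_def, Complex.conj_ofReal]
  have hD' : ∀ i j : {p // wilsonBox (0 : TorusSite 4 N) s p},
      star ((((σ * τ : ℝ) : ℂ) • wilsonCell U μ 0 s) j i) =
        (σ : ℂ) * gammaFive i.1.2.2 i.1.2.2 * (((σ * τ : ℝ) : ℂ) • wilsonCell U μ 0 s) i j *
          ((σ : ℂ) * gammaFive j.1.2.2 j.1.2.2) := fun i j => by
    rw [Matrix.smul_apply, Matrix.smul_apply, smul_eq_mul, smul_eq_mul, star_mul',
      star_wilsonCell_apply U μ s i j, Complex.star_def, Complex.conj_ofReal]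
    push_cast
    linear_combination
      (-((σ : ℂ) * τ * (gammaFive i.1.2.2 i.1.2.2 * wilsonCell U μ 0 s i j * gammaFive j.1.2.2 j.1.2.2))) * hσC
  have heig' : (((σ * τ : ℝ) : ℂ) • wilsonCell U μ 0 s) *ᵥ u =
      fun p => ((τ * ev : ℝ) : ℂ) * ((σ : ℂ) * gammaFive p.1.2.2 p.1.2.2) * u p := by
    rw [Matrix.smul_mulVec, heig]
    funext p
    simp only [Pi.smul_apply, smul_eq_mul]
    push_cast
    ring
  have hev' : 0 < τ * ev := hτev
  obtain ⟨x, hx, halt⟩ := chiHermitian_member_forces_crossing_or_nonchiral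
    (((σ * τ : ℝ) : ℂ) • wilsonCell U μ 0 s) (fun p => (σ : ℂ) * gammaFive p.1.2.2 p.1.2.2) hχ2' hχs'
    hD' u hu0 hev' hχ₀ hχ₁ heig'
  refine ⟨x, hx.1, hx.2, ?_⟩
  -- `στ·D_c(μ) − x·1 = στ · D_c(μ − στx)`
  have hcoef : ((σ * τ : ℝ) : ℂ) * (((μ - σ * τ * x - μ : ℝ)) : ℂ) = -((x : ℝ) : ℂ) := by
    push_cast
    linear_combination (-(x : ℂ) * τ * τ) * hσC + (-(x : ℂ)) * hτC
  have hshift : ((σ * τ : ℝ) : ℂ) • wilsonCell U μ 0 s - ((x : ℝ) : ℂ) • (1 : Matrix _ _ ℂ) =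
      ((σ * τ : ℝ) : ℂ) • wilsonCell U (μ - σ * τ * x) 0 s := by
    rw [Summit.QuantumFields.QCD.Theorems.NestedDissectionSeaCoerciveSea.wilsonCell_eq_add_scalar_sub
      U (μ - σ * τ * x) μ 0 s, smul_add, Matrix.scalar_apply, ← Matrix.smul_one_eq_diagonal,
      smul_smul, hcoef, neg_smul, sub_eq_add_neg]
  have hστsq : ((σ * τ : ℝ) : ℂ) * ((σ * τ : ℝ) : ℂ) = 1 := by
    push_cast
    linear_combination ((τ : ℂ) * τ) * hσC + hτC
  rcases halt with hdet | ⟨v, hv0, c, hv, hc, hce, hform⟩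
  · left
    rw [hshift, det_smul] at hdet
    rcases mul_eq_zero.1 hdet with h | h
    · exact absurd h (pow_ne_zero _ hστ0)
    · exact h
  · right
    refine ⟨v, hv0, τ * c, ?_, by nlinarith [hτ2], by nlinarith [hτ2], ?_⟩
    · rw [hshift, Matrix.smul_mulVec] at hv
      funext p
      have hp := congrFun hv p
      simp only [Pi.smul_apply, smul_eq_mul] at hp
      calc (wilsonCell U (μ - σ * τ * x) 0 s *ᵥ v) p
          = ((σ * τ : ℝ) : ℂ) * (((σ * τ : ℝ) : ℂ) * (wilsonCell U (μ - σ * τ * x) 0 s *ᵥ v) p) := by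
            rw [← mul_assoc, hστsq, one_mul]
        _ = ((σ * τ : ℝ) : ℂ) * ((c : ℂ) * ((σ : ℂ) * gammaFive p.1.2.2 p.1.2.2) * v p) := by rw [hp]
        _ = ((τ * c : ℝ) : ℂ) * gammaFive p.1.2.2 p.1.2.2 * v p := by
            push_cast
            linear_combination ((τ : ℂ) * c * gammaFive p.1.2.2 p.1.2.2 * v p) * hσC
    · have hsum : (∑ p, star (v p) * ((σ : ℂ) * gammaFive p.1.2.2 p.1.2.2) * v p) =
          (σ : ℂ) * ∑ p, star (v p) * gammaFive p.1.2.2 p.1.2.2 * v p := by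
        rw [Finset.mul_sum]
        exact Finset.sum_congr rfl fun p _ => by ring
      rw [hsum, Complex.re_ofReal_mul] at hform
      exact hform


end ChiralForcesCrossing

end Summit.QuantumFields.QCD.Cruxes.CoerciveSea.ChiralityCollapsesPseudospectrum

end
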